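import Literature.Probability.RandomPlanarGeometry.HexSAWBrickWallStripFugacityLevel0
import HarnessLib

/-!
# A renewal lower bound for the one-level strip `S_1` (the hexagon chain): forward walks

In the strip `S_1 = ℤ × {0,1}` of the brick wall (rungs at even abscissae; level-`0` vertices = bottom sites
with odd abscissa, weight `y` each, as in `HexSAWBrickWallStripFugacityLevel0.lean`) we single out three
families of *forward* self-avoiding walks from the origin, by the state of their endpoint:

* `FB n` — walks of `S_n(S_1)` from `(0,0)` ending on the bottom row at an even abscissa `X` with every site
  at abscissa `≤ X`;
* `FT n` — the same, ending on the top row;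
* `FT2 n ⊆ FT n` — ending on the top row with every *other* site at abscissa `< X`.

Appending a bottom run of two steps (`FB n → FB (n+2)`, one new level-`0` vertex), a bottom run plus the
up-rung (`FB n → FT (n+3)`, one new level-`0` vertex), a top run (`FT n → FT2 (n+2)`) or the down-rung
(`FT2 n → FB (n+1)`) gives injective maps with disjoint images, whence the **renewal inequalities**
`y·b_n + t⁽²⁾_{n+1} ≤ b_{n+2}`, `y·b_n + t_{n+1} ≤ t_{n+3}`, `t_n ≤ t⁽²⁾_{n+2}`, `1 ≤ b_0`, `b_n ≤ C_{1,n}(y,1)`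
for the weighted counts `b, t, t⁽²⁾` (`bB, bT, bT2`).  Summing the generating functions gives the
**divergence criterion** `not_summable_stripZ₀_one_mul_pow`: if `0 < x`, `x² < 1`, `0 ≤ y` and
`(1 − y x²)(1 − x²) ≤ y x⁶` then `Σ_n C_{1,n}(y,1) xⁿ = ∞`.  (The polynomial `1 − (1+y)u + y u² − y u³`,
`u = x²`, is `det(1 − M)` for the three-state forward automaton; its root at `u = 1/(2+√2)` is
`y = (10 + 8√2)/7`, used in `HexSAWStripOneRenewalThreshold.lean` to bound the first threshold `y'_1`.)

References: the strip partition functions and thresholds are those of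
[BeatonBousquetMelouDeGierDuminilCopinGuttmann2014, §3.2 and Corollary 8 (arXiv v5 pp. 10, 12)];
forward ("directed") walks in a strip and their rational generating functions are classical
[MadrasSlade1993, §8.2]; the brickwork chart of the honeycomb lattice is [EntingJensen2009, §7.4.2, Fig. 7.10].
-/

open Filter Topology Finset Literature.Probability.LatticeModels Literature.Probability.Percolation SimpleGraph

namespace Literature.Probability.RandomPlanarGeometry.SAW.HexBW

variable {n ℓ : ℕ} {pat υ : ℕ → Site 2} {p q : Site 2 × (ℕ → Site 2)} {y x : ℝ}

/-! ### Extension of a frozen walk by a relative pattern -/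

/-- Two sites of `ℤ²` with equal coordinates are equal (private copy of the tree's `Contour.site_ext`, kept local to avoid an import
across topics). [folklore]
[cite: DuminilCopinSmirnov2012, §3 (the strip S_T of the hexagonal lattice; here in its brick-wall embedding in ℤ², a site has two integer coordinates); lane plumbing] -/
private theorem site_ext' {a b : Site 2} (h0 : a 0 = b 0) (h1 : a 1 = b 1) : a = b :=
  funext fun j => (Fin.forall_fin_two (p := fun j => a j = b j)).2 ⟨h0, h1⟩ j

/-- Extend the walk `υ` (frozen after time `n`) by the relative pattern `pat` of length `ℓ` attached at `υ n`.
[cite: MadrasSlade1993, §1.2 (concatenation of walks)] -/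
def extWalk (n ℓ : ℕ) (pat : ℕ → Site 2) (υ : ℕ → Site 2) : ℕ → Site 2 :=
  fun i => if i ≤ n then υ i else pat (min (i - n) ℓ) + υ n

/-- Before the freezing time the extended walk is `υ`. [cite: MadrasSlade1993, §1.2 (concatenation of walks); lane plumbing, not in print] -/
theorem extWalk_of_le {i : ℕ} (h : i ≤ n) : extWalk n ℓ pat υ i = υ i := if_pos h

/-- After the freezing time the extended walk follows the translated pattern. [cite: MadrasSlade1993, §1.2 (concatenation of walks); lane plumbing, not in print] -/
theorem extWalk_of_lt {i : ℕ} (h : n < i) : extWalk n ℓ pat υ i = pat (min (i - n) ℓ) + υ n :=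
  if_neg (not_le.2 h)

/-- The extended walk at time `n + k`. [cite: MadrasSlade1993, §1.2 (concatenation of walks); lane plumbing, not in print] -/
theorem extWalk_add (h0 : pat 0 = 0) (k : ℕ) : extWalk n ℓ pat υ (n + k) = pat (min k ℓ) + υ n := by
  rcases Nat.eq_zero_or_pos k with rfl | hk
  · rw [extWalk_of_le (by omega), Nat.zero_min, h0, zero_add, Nat.add_zero]
  · rw [extWalk_of_lt (by omega), Nat.add_sub_cancel_left]

/-- The extended walk at time `n + k`, `k ≤ ℓ`. [cite: MadrasSlade1993, §1.2 (concatenation of walks); lane plumbing, not in print] -/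
theorem extWalk_add_of_le (h0 : pat 0 = 0) {k : ℕ} (hk : k ≤ ℓ) :
    extWalk n ℓ pat υ (n + k) = pat k + υ n := by
  rw [extWalk_add h0, min_eq_left hk]

/-- The extended walk is a walk of `S_{n+ℓ}(S_1)` from the origin class, provided the pattern steps are
brick-wall bonds, the new sites are fresh and in the strip, and the pattern is injective.
[cite: MadrasSlade1993, §1.2 (concatenation of walks), §8.2 (walks in a strip)] -/
theorem ext_mem_stripPairs (hp : ((0 : Site 2), υ) ∈ stripPairs 1 n) (h0 : pat 0 = 0)
    (hadj : ∀ k < ℓ, brickWallGraph.Adj (pat k + υ n) (pat (k + 1) + υ n))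
    (hfresh : ∀ m ≤ n, ∀ k, 1 ≤ k → k ≤ ℓ → υ m ≠ pat k + υ n)
    (hinj : ∀ k k', k ≤ ℓ → k' ≤ ℓ → pat k = pat k' → k = k')
    (hstrip : ∀ k ≤ ℓ, InStrip 1 (pat k + υ n)) :
    ((0 : Site 2), extWalk n ℓ pat υ) ∈ stripPairs 1 (n + ℓ) := by
  rw [mem_stripPairs] at hp ⊢
  obtain ⟨hst, hsaw, hbw, hin⟩ := hp
  simp only [zero_add] at hbw hin ⊢
  rw [Zd.mem_saws] at hsaw
  obtain ⟨h00, hfrz, hzd, hinjυ⟩ := hsaw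
  have hval : ∀ i ≤ n + ℓ, n < i → ∃ k, 1 ≤ k ∧ k ≤ ℓ ∧ i = n + k ∧ extWalk n ℓ pat υ i = pat k + υ n :=
    fun i hi hni => ⟨i - n, by omega, by omega, by omega, by
      rw [extWalk_of_lt hni, min_eq_left (by omega : i - n ≤ ℓ)]⟩
  refine ⟨hst, ?_, ?_, ?_⟩
  · rw [Zd.mem_saws]
    refine ⟨by rw [extWalk_of_le (Nat.zero_le _)]; exact h00, fun i hi => ?_, fun i hi => ?_, ?_⟩
    · obtain ⟨k, rfl⟩ : ∃ k, i = n + k := ⟨i - n, by omega⟩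
      rw [extWalk_add h0, extWalk_add h0, min_eq_right (by omega : ℓ ≤ k), min_self]
    · rcases lt_or_ge i n with hin' | hin'
      · rw [extWalk_of_le hin'.le, extWalk_of_le (by omega)]
        exact hzd i hin'
      · obtain ⟨k, rfl⟩ : ∃ k, i = n + k := ⟨i - n, by omega⟩
        rw [extWalk_add h0, show n + k + 1 = n + (k + 1) by omega, extWalk_add h0,
          min_eq_left (by omega : k ≤ ℓ), min_eq_left (by omega : k + 1 ≤ ℓ)]
        exact zd_adj_of_adj (hadj k (by omega))
    · intro i hi j hj hij
      simp only [Set.mem_setOf_eq] at hi hj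
      rcases le_or_gt i n with hi' | hi' <;> rcases le_or_gt j n with hj' | hj'
      · rw [extWalk_of_le hi', extWalk_of_le hj'] at hij
        exact hinjυ hi' hj' hij
      · obtain ⟨k, hk1, hkℓ, rfl, hv⟩ := hval j hj hj'
        rw [extWalk_of_le hi', hv] at hij
        exact absurd hij (hfresh i hi' k hk1 hkℓ)
      · obtain ⟨k, hk1, hkℓ, rfl, hv⟩ := hval i hi hi'
        rw [extWalk_of_le hj', hv] at hij
        exact absurd hij.symm (hfresh j hj' k hk1 hkℓ)
      · obtain ⟨k, hk1, hkℓ, rfl, hv⟩ := hval i hi hi'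
        obtain ⟨k', hk1', hkℓ', rfl, hv'⟩ := hval j hj hj'
        rw [hv, hv'] at hij
        rw [hinj k k' hkℓ hkℓ' (add_right_cancel hij)]
  · intro i hi
    show brickWallGraph.Adj (extWalk n ℓ pat υ i) (extWalk n ℓ pat υ (i + 1))
    rcases lt_or_ge i n with hin' | hin'
    · rw [extWalk_of_le hin'.le, extWalk_of_le (by omega)]
      exact hbw i hin'
    · obtain ⟨k, rfl⟩ : ∃ k, i = n + k := ⟨i - n, by omega⟩
      rw [extWalk_add h0, show n + k + 1 = n + (k + 1) by omega, extWalk_add h0,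
        min_eq_left (by omega : k ≤ ℓ), min_eq_left (by omega : k + 1 ≤ ℓ)]
      exact hadj k (by omega)
  · intro m hm
    rcases le_or_gt m n with hm' | hm'
    · rw [extWalk_of_le hm']
      exact hin m hm'
    · obtain ⟨k, -, hkℓ, rfl, hv⟩ := hval m hm hm'
      rw [hv]
      exact hstrip k hkℓ

/-- The level-`0` count of the extended walk: the old count plus the new sites' contributions.
[cite: BeatonBousquetMelouDeGierDuminilCopinGuttmann2014, §3.2 (arXiv v5 p. 10: bc(ω))] -/
theorem bottomVisits₀_extWalk (h0 : pat 0 = 0) :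
    bottomVisits₀ 0 (extWalk n ℓ pat υ) (n + ℓ) = bottomVisits₀ 0 υ n +
      ∑ k ∈ Finset.range ℓ, (if (pat (k + 1) + υ n) 1 = 0 ∧ (pat (k + 1) + υ n) 0 % 2 = 1 then 1 else 0) := by
  unfold bottomVisits₀
  simp only [zero_add]
  rw [show n + ℓ + 1 = (n + 1) + ℓ by omega, Finset.sum_range_add]
  congr 1
  · exact Finset.sum_congr rfl fun m hm => by
      rw [extWalk_of_le (Nat.lt_succ_iff.1 (Finset.mem_range.1 hm))]
  · exact Finset.sum_congr rfl fun k hk => by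
      rw [show n + 1 + k = n + (k + 1) by omega, extWalk_add h0,
        min_eq_left (Nat.succ_le_of_lt (Finset.mem_range.1 hk))]

/-- Extension is injective on frozen walks. [cite: MadrasSlade1993, §1.2] -/
theorem extWalk_injective_of_frozen {υ υ' : ℕ → Site 2} (hυ : ∀ i, n ≤ i → υ i = υ n)
    (hυ' : ∀ i, n ≤ i → υ' i = υ' n) (h : extWalk n ℓ pat υ = extWalk n ℓ pat υ') : υ = υ' := by
  have hle : ∀ i ≤ n, υ i = υ' i := fun i hi => by
    have := congrFun h i
    rwa [extWalk_of_le hi, extWalk_of_le hi] at this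
  funext i
  rcases le_or_gt i n with hi | hi
  · exact hle i hi
  · rw [hυ i hi.le, hυ' i hi.le, hle n le_rfl]

/-! ### The three patterns -/

/-- Run of `k` steps to the right. [cite: EntingJensen2009, §7.4.2, Fig. 7.10] -/
def patR (k : ℕ) : Site 2 := ![(k : ℤ), 0]
/-- Two steps to the right, then the up-rung. [cite: EntingJensen2009, §7.4.2, Fig. 7.10] -/
def patU (k : ℕ) : Site 2 := ![if k ≤ 2 then (k : ℤ) else 2, if k ≤ 2 then 0 else 1]
/-- The down-rung. [cite: EntingJensen2009, §7.4.2, Fig. 7.10] -/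
def patD (k : ℕ) : Site 2 := ![0, if k = 0 then 0 else -1]

/-- Abscissa of the pattern `R`. [cite: MadrasSlade1993, §1.2 (concatenation of walks); lane plumbing, not in print] -/
@[simp] theorem patR_zero (k : ℕ) : patR k 0 = k := rfl
/-- Ordinate of the pattern `R`. [cite: MadrasSlade1993, §1.2 (concatenation of walks); lane plumbing, not in print] -/
@[simp] theorem patR_one (k : ℕ) : patR k 1 = 0 := rfl
/-- Abscissa of the pattern `U`. [cite: MadrasSlade1993, §1.2 (concatenation of walks); lane plumbing, not in print] -/
@[simp] theorem patU_zero (k : ℕ) : patU k 0 = if k ≤ 2 then (k : ℤ) else 2 := rfl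
/-- Ordinate of the pattern `U`. [cite: MadrasSlade1993, §1.2 (concatenation of walks); lane plumbing, not in print] -/
@[simp] theorem patU_one (k : ℕ) : patU k 1 = if k ≤ 2 then 0 else 1 := rfl
/-- Abscissa of the pattern `D`. [cite: MadrasSlade1993, §1.2 (concatenation of walks); lane plumbing, not in print] -/
@[simp] theorem patD_zero (k : ℕ) : patD k 0 = 0 := rfl
/-- Ordinate of the pattern `D`. [cite: MadrasSlade1993, §1.2 (concatenation of walks); lane plumbing, not in print] -/
@[simp] theorem patD_one (k : ℕ) : patD k 1 = if k = 0 then 0 else -1 := rfl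

/-- The patterns start at the origin. [cite: MadrasSlade1993, §1.2 (concatenation of walks); lane plumbing, not in print] -/
theorem patR_at_zero : patR 0 = 0 := site_ext' (by simp) (by simp)
/-- The patterns start at the origin. [cite: MadrasSlade1993, §1.2 (concatenation of walks); lane plumbing, not in print] -/
theorem patU_at_zero : patU 0 = 0 := site_ext' (by simp) (by simp)
/-- The patterns start at the origin. [cite: MadrasSlade1993, §1.2 (concatenation of walks); lane plumbing, not in print] -/
theorem patD_at_zero : patD 0 = 0 := site_ext' (by simp) (by simp)

/-- The pattern `R` is injective in time. [cite: MadrasSlade1993, §1.2 (concatenation of walks); lane plumbing, not in print] -/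
theorem patR_inj (k k' : ℕ) (h : patR k = patR k') : k = k' := by
  have := congrFun h 0; simp only [patR_zero] at this; exact_mod_cast this

/-- The pattern `U` is injective in time (`k ≤ 3`). [cite: MadrasSlade1993, §1.2 (concatenation of walks); lane plumbing, not in print] -/
theorem patU_inj (k k' : ℕ) (hk : k ≤ 3) (hk' : k' ≤ 3) (h : patU k = patU k') : k = k' := by
  have h0 := congrFun h 0; have h1 := congrFun h 1
  simp only [patU_zero, patU_one] at h0 h1
  split_ifs at h0 h1 <;> omega

/-- The pattern `D` is injective in time (`k ≤ 1`). [cite: MadrasSlade1993, §1.2 (concatenation of walks); lane plumbing, not in print] -/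
theorem patD_inj (k k' : ℕ) (hk : k ≤ 1) (hk' : k' ≤ 1) (h : patD k = patD k') : k = k' := by
  have h1 := congrFun h 1
  simp only [patD_one] at h1
  split_ifs at h1 <;> omega

/-! ### The three families of forward walks -/

open Classical in
/-- `FB n`: forward walks of `S_n(S_1)` from `(0,0)` ending on the bottom row at an even abscissa dominating
all abscissae of the walk. [cite: MadrasSlade1993, §8.2] -/
noncomputable def FB (n : ℕ) : Finset (Site 2 × (ℕ → Site 2)) := (stripPairs 1 n).filter fun p =>
  p.1 = 0 ∧ p.2 n 1 = 0 ∧ p.2 n 0 % 2 = 0 ∧ ∀ m ≤ n, p.2 m 0 ≤ p.2 n 0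

open Classical in
/-- `FT n`: the same, ending on the top row. [cite: MadrasSlade1993, §8.2] -/
noncomputable def FT (n : ℕ) : Finset (Site 2 × (ℕ → Site 2)) := (stripPairs 1 n).filter fun p =>
  p.1 = 0 ∧ p.2 n 1 = 1 ∧ p.2 n 0 % 2 = 0 ∧ ∀ m ≤ n, p.2 m 0 ≤ p.2 n 0

open Classical in
/-- `FT2 n`: ending on the top row, every other site strictly to the left. [cite: MadrasSlade1993, §8.2] -/
noncomputable def FT2 (n : ℕ) : Finset (Site 2 × (ℕ → Site 2)) := (stripPairs 1 n).filter fun p =>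
  p.1 = 0 ∧ p.2 n 1 = 1 ∧ p.2 n 0 % 2 = 0 ∧ ∀ m < n, p.2 m 0 < p.2 n 0

/-- Membership in the forward family `FB n` (bottom endpoint). [cite: BeatonBousquetMelouDeGierDuminilCopinGuttmann2014, §3.2 (arXiv v5 p. 10: the walks confined to the strip S_T and their bottom contacts bc(ω) in C_{T,k}(y,z)); lane bookkeeping, not in print] -/
theorem mem_FB : p ∈ FB n ↔ p ∈ stripPairs 1 n ∧
    (p.1 = 0 ∧ p.2 n 1 = 0 ∧ p.2 n 0 % 2 = 0 ∧ ∀ m ≤ n, p.2 m 0 ≤ p.2 n 0) := by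
  classical
  exact Finset.mem_filter
/-- Membership in the forward family `FT n` (top endpoint). [cite: BeatonBousquetMelouDeGierDuminilCopinGuttmann2014, §3.2 (arXiv v5 p. 10: the walks confined to the strip S_T and their bottom contacts bc(ω) in C_{T,k}(y,z)); lane bookkeeping, not in print] -/
theorem mem_FT : p ∈ FT n ↔ p ∈ stripPairs 1 n ∧
    (p.1 = 0 ∧ p.2 n 1 = 1 ∧ p.2 n 0 % 2 = 0 ∧ ∀ m ≤ n, p.2 m 0 ≤ p.2 n 0) := by
  classical
  exact Finset.mem_filter
/-- Membership in the forward family `FT2 n` (top endpoint, strict record). [cite: BeatonBousquetMelouDeGierDuminilCopinGuttmann2014, §3.2 (arXiv v5 p. 10: the walks confined to the strip S_T and their bottom contacts bc(ω) in C_{T,k}(y,z)); lane bookkeeping, not in print] -/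
theorem mem_FT2 : p ∈ FT2 n ↔ p ∈ stripPairs 1 n ∧
    (p.1 = 0 ∧ p.2 n 1 = 1 ∧ p.2 n 0 % 2 = 0 ∧ ∀ m < n, p.2 m 0 < p.2 n 0) := by
  classical
  exact Finset.mem_filter

/-- `FT2 n ⊆ FT n`. [cite: BeatonBousquetMelouDeGierDuminilCopinGuttmann2014, §3.2 (arXiv v5 p. 10: the walks confined to the strip S_T and their bottom contacts bc(ω) in C_{T,k}(y,z)); lane bookkeeping, not in print] -/
theorem FT2_subset_FT (n : ℕ) : FT2 n ⊆ FT n := fun q hq => by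
  obtain ⟨hq, h1, hrow, hpar, hmax⟩ := mem_FT2.1 hq
  exact mem_FT.2 ⟨hq, h1, hrow, hpar, fun m hm => by
    rcases lt_or_eq_of_le hm with hm' | rfl
    · exact (hmax m hm').le
    · exact le_rfl⟩

/-- The weighted counts `b_n, t_n, t⁽²⁾_n`. [cite: BeatonBousquetMelouDeGierDuminilCopinGuttmann2014, §3.2 (arXiv v5 p. 10)] -/
noncomputable def bB (n : ℕ) (y : ℝ) : ℝ := ∑ p ∈ FB n, y ^ bottomVisits₀ p.1 p.2 n
/-- See `bB`. [cite: BeatonBousquetMelouDeGierDuminilCopinGuttmann2014, §3.2 (arXiv v5 p. 10)] -/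
noncomputable def bT (n : ℕ) (y : ℝ) : ℝ := ∑ p ∈ FT n, y ^ bottomVisits₀ p.1 p.2 n
/-- See `bB`. [cite: BeatonBousquetMelouDeGierDuminilCopinGuttmann2014, §3.2 (arXiv v5 p. 10)] -/
noncomputable def bT2 (n : ℕ) (y : ℝ) : ℝ := ∑ p ∈ FT2 n, y ^ bottomVisits₀ p.1 p.2 n

/-- `0 ≤ bB n y` for `y ≥ 0`. [cite: BeatonBousquetMelouDeGierDuminilCopinGuttmann2014, §3.2 (arXiv v5 p. 10: the walks confined to the strip S_T and their bottom contacts bc(ω) in C_{T,k}(y,z)); lane bookkeeping, not in print] -/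
theorem bB_nonneg (n : ℕ) (hy : 0 ≤ y) : 0 ≤ bB n y := Finset.sum_nonneg fun _ _ => pow_nonneg hy _
/-- `0 ≤ bT n y` for `y ≥ 0`. [cite: BeatonBousquetMelouDeGierDuminilCopinGuttmann2014, §3.2 (arXiv v5 p. 10: the walks confined to the strip S_T and their bottom contacts bc(ω) in C_{T,k}(y,z)); lane bookkeeping, not in print] -/
theorem bT_nonneg (n : ℕ) (hy : 0 ≤ y) : 0 ≤ bT n y := Finset.sum_nonneg fun _ _ => pow_nonneg hy _
/-- `0 ≤ bT2 n y` for `y ≥ 0`. [cite: BeatonBousquetMelouDeGierDuminilCopinGuttmann2014, §3.2 (arXiv v5 p. 10: the walks confined to the strip S_T and their bottom contacts bc(ω) in C_{T,k}(y,z)); lane bookkeeping, not in print] -/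
theorem bT2_nonneg (n : ℕ) (hy : 0 ≤ y) : 0 ≤ bT2 n y := Finset.sum_nonneg fun _ _ => pow_nonneg hy _

/-- `bB n y ≤ C_{1,n}(y,1)` (a sub-sum). [cite: BeatonBousquetMelouDeGierDuminilCopinGuttmann2014, §3.2 (arXiv v5 p. 10: the walks confined to the strip S_T and their bottom contacts bc(ω) in C_{T,k}(y,z)); lane bookkeeping, not in print] -/
theorem bB_le_stripZ₀ (n : ℕ) (hy : 0 ≤ y) : bB n y ≤ stripZ₀ 1 n y := by
  classical
  exact Finset.sum_le_sum_of_subset_of_nonneg (Finset.filter_subset _ _) fun _ _ _ => pow_nonneg hy _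
/-- `bT n y ≤ C_{1,n}(y,1)` (a sub-sum). [cite: BeatonBousquetMelouDeGierDuminilCopinGuttmann2014, §3.2 (arXiv v5 p. 10: the walks confined to the strip S_T and their bottom contacts bc(ω) in C_{T,k}(y,z)); lane bookkeeping, not in print] -/
theorem bT_le_stripZ₀ (n : ℕ) (hy : 0 ≤ y) : bT n y ≤ stripZ₀ 1 n y := by
  classical
  exact Finset.sum_le_sum_of_subset_of_nonneg (Finset.filter_subset _ _) fun _ _ _ => pow_nonneg hy _
/-- `bT2 n y ≤ C_{1,n}(y,1)` (a sub-sum). [cite: BeatonBousquetMelouDeGierDuminilCopinGuttmann2014, §3.2 (arXiv v5 p. 10: the walks confined to the strip S_T and their bottom contacts bc(ω) in C_{T,k}(y,z)); lane bookkeeping, not in print] -/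
theorem bT2_le_stripZ₀ (n : ℕ) (hy : 0 ≤ y) : bT2 n y ≤ stripZ₀ 1 n y := by
  classical
  exact Finset.sum_le_sum_of_subset_of_nonneg (Finset.filter_subset _ _) fun _ _ _ => pow_nonneg hy _

/-- Walks from the origin class start on the bottom row, so `t_0 = 0`. [cite: MadrasSlade1993, §1.1] -/
theorem bT_zero (y : ℝ) : bT 0 y = 0 := by
  refine Finset.sum_eq_zero fun p hp => ?_
  exfalso
  obtain ⟨hp, -, h1, -⟩ := mem_FT.1 hp
  have h00 := (Zd.mem_saws.1 (mem_stripPairs.1 hp).2.1).1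
  rw [h00] at h1
  exact absurd h1 (by simp)

/-- `t⁽²⁾_0 = 0`. [cite: MadrasSlade1993, §1.1] -/
theorem bT2_zero (y : ℝ) : bT2 0 y = 0 := by
  refine Finset.sum_eq_zero fun p hp => ?_
  exfalso
  obtain ⟨hp, -, h1, -⟩ := mem_FT2.1 hp
  have h00 := (Zd.mem_saws.1 (mem_stripPairs.1 hp).2.1).1
  rw [h00] at h1
  exact absurd h1 (by simp)

/-- The zero-step walk at the origin is in `FB 0`, so `1 ≤ b_0`. [cite: MadrasSlade1993, §1.1] -/
theorem one_le_bB_zero (hy : 0 ≤ y) : 1 ≤ bB 0 y := by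
  have hmem : ((0 : Site 2), fun _ : ℕ => (0 : Site 2)) ∈ FB 0 := by
    refine mem_FB.2 ⟨mem_stripPairs.2 ⟨?_, ?_, fun i hi => absurd hi (Nat.not_lt_zero _), fun m _ => ?_⟩,
      rfl, by simp, by simp, fun m _ => le_rfl⟩
    · exact mem_stripStarts.2 ⟨⟨le_rfl, zero_le_one⟩, le_rfl, by simp⟩
    · rw [Zd.mem_saws]
      exact ⟨rfl, fun _ _ => rfl, fun i hi => absurd hi (Nat.not_lt_zero _), fun i hi j hj _ => by
        simp only [Set.mem_setOf_eq, Nat.le_zero] at hi hj; rw [hi, hj]⟩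
    · refine ⟨?_, ?_⟩ <;> simp
  have hw : y ^ bottomVisits₀ (0 : Site 2) (fun _ : ℕ => (0 : Site 2)) 0 = 1 := by
    unfold bottomVisits₀; simp
  calc (1 : ℝ) = y ^ bottomVisits₀ (0 : Site 2) (fun _ : ℕ => (0 : Site 2)) 0 := hw.symm
    _ ≤ bB 0 y := Finset.single_le_sum (f := fun p : Site 2 × (ℕ → Site 2) => y ^ bottomVisits₀ p.1 p.2 0)
        (fun _ _ => pow_nonneg hy _) hmem

/-! ### The four extension maps -/

/-- Bottom run: `FB n → FB (n+2)`, one new level-`0` vertex. [cite: MadrasSlade1993, §8.2] -/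
theorem extR_mem_FB (hp : p ∈ FB n) : ((0 : Site 2), extWalk n 2 patR p.2) ∈ FB (n + 2) ∧
    bottomVisits₀ 0 (extWalk n 2 patR p.2) (n + 2) = bottomVisits₀ p.1 p.2 n + 1 ∧
    extWalk n 2 patR p.2 (n + 1) 1 = 0 := by
  obtain ⟨hp, h1, hrow, hpar, hmax⟩ := mem_FB.1 hp
  have hp' : ((0 : Site 2), p.2) ∈ stripPairs 1 n := by rw [← h1]; exact hp
  have hmem := ext_mem_stripPairs (ℓ := 2) hp' patR_at_zero
    (fun k hk => by
      simp only [brickWallGraph_adj_coord, Pi.add_apply, patR_zero, patR_one, hrow]; push_cast; (first | omega | (simp only [and_true, false_and, and_false, or_false] at *; omega)))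
    (fun m hm k hk1 hk2 h => by
      have := congrFun h 0; simp only [Pi.add_apply, patR_zero] at this
      have := hmax m hm; omega)
    (fun k k' _ _ h => patR_inj k k' h)
    (fun k hk => by simp only [InStrip, Pi.add_apply, patR_one, hrow]; omega)
  refine ⟨mem_FB.2 ⟨hmem, rfl, ?_, ?_, fun m hm => ?_⟩, ?_, ?_⟩
  · dsimp only; rw [extWalk_add_of_le patR_at_zero (le_refl 2)]; simp only [Pi.add_apply, patR_one, hrow]; omega
  · dsimp only; rw [extWalk_add_of_le patR_at_zero (le_refl 2)]; simp only [Pi.add_apply, patR_zero]; omega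
  · dsimp only; rw [extWalk_add_of_le patR_at_zero (le_refl 2)]
    rcases le_or_gt m n with hm' | hm'
    · rw [extWalk_of_le hm']; simp only [Pi.add_apply, patR_zero]; have := hmax m hm'; omega
    · obtain ⟨k, rfl⟩ : ∃ k, m = n + k := ⟨m - n, by omega⟩
      rw [extWalk_add_of_le patR_at_zero (by omega : k ≤ 2)]; simp only [Pi.add_apply, patR_zero]; omega
  · rw [bottomVisits₀_extWalk patR_at_zero, h1]
    simp only [Finset.sum_range_succ, Finset.sum_range_zero, Pi.add_apply, patR_zero, patR_one, hrow]
    push_cast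
    split_ifs <;> (first | omega | (simp only [true_and] at *; omega))
  · rw [extWalk_add_of_le patR_at_zero (by norm_num : 1 ≤ 2)]; simp only [Pi.add_apply, patR_one, hrow]; omega

/-- Bottom run and up-rung: `FB n → FT (n+3)`, one new level-`0` vertex. [cite: MadrasSlade1993, §8.2] -/
theorem extU_mem_FT (hp : p ∈ FB n) : ((0 : Site 2), extWalk n 3 patU p.2) ∈ FT (n + 3) ∧
    bottomVisits₀ 0 (extWalk n 3 patU p.2) (n + 3) = bottomVisits₀ p.1 p.2 n + 1 ∧
    extWalk n 3 patU p.2 (n + 2) 1 = 0 := by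
  obtain ⟨hp, h1, hrow, hpar, hmax⟩ := mem_FB.1 hp
  have hp' : ((0 : Site 2), p.2) ∈ stripPairs 1 n := by rw [← h1]; exact hp
  have hmem := ext_mem_stripPairs (ℓ := 3) hp' patU_at_zero
    (fun k hk => by
      simp only [brickWallGraph_adj_coord, Pi.add_apply, patU_zero, patU_one, hrow]
      split_ifs <;> push_cast <;> (first | omega | (simp only [true_and, and_true, false_and, and_false, or_false, false_or] at *; omega)))
    (fun m hm k hk1 hk2 h => by
      have := congrFun h 0; simp only [Pi.add_apply, patU_zero] at this
      have := hmax m hm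
      split_ifs at * <;> omega)
    (fun k k' hk hk' h => patU_inj k k' hk hk' h)
    (fun k hk => by simp only [InStrip, Pi.add_apply, patU_one, hrow]; split_ifs <;> omega)
  refine ⟨mem_FT.2 ⟨hmem, rfl, ?_, ?_, fun m hm => ?_⟩, ?_, ?_⟩
  · dsimp only; rw [extWalk_add_of_le patU_at_zero (le_refl 3)]; simp only [Pi.add_apply, patU_one, hrow]; split_ifs <;> omega
  · dsimp only; rw [extWalk_add_of_le patU_at_zero (le_refl 3)]; simp only [Pi.add_apply, patU_zero]; split_ifs <;> omega
  · dsimp only; rw [extWalk_add_of_le patU_at_zero (le_refl 3)]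
    rcases le_or_gt m n with hm' | hm'
    · rw [extWalk_of_le hm']; simp only [Pi.add_apply, patU_zero]; have := hmax m hm'
      split_ifs <;> omega
    · obtain ⟨k, rfl⟩ : ∃ k, m = n + k := ⟨m - n, by omega⟩
      rw [extWalk_add_of_le patU_at_zero (by omega : k ≤ 3)]; simp only [Pi.add_apply, patU_zero]
      split_ifs <;> push_cast <;> omega
  · rw [bottomVisits₀_extWalk patU_at_zero, h1]
    simp only [Finset.sum_range_succ, Finset.sum_range_zero, Pi.add_apply, patU_zero, patU_one, hrow]
    push_cast
    split_ifs <;> (first | omega | (simp only [true_and, false_and, not_false_eq_true] at *; omega))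
  · rw [extWalk_add_of_le patU_at_zero (by norm_num : 2 ≤ 3)]; simp only [Pi.add_apply, patU_one, hrow]
    split_ifs <;> omega

/-- Top run: `FT n → FT2 (n+2)`, no new level-`0` vertex. [cite: MadrasSlade1993, §8.2] -/
theorem extR_mem_FT2 (hp : p ∈ FT n) : ((0 : Site 2), extWalk n 2 patR p.2) ∈ FT2 (n + 2) ∧
    bottomVisits₀ 0 (extWalk n 2 patR p.2) (n + 2) = bottomVisits₀ p.1 p.2 n ∧
    extWalk n 2 patR p.2 (n + 1) 1 = 1 := by
  obtain ⟨hp, h1, hrow, hpar, hmax⟩ := mem_FT.1 hp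
  have hp' : ((0 : Site 2), p.2) ∈ stripPairs 1 n := by rw [← h1]; exact hp
  have hmem := ext_mem_stripPairs (ℓ := 2) hp' patR_at_zero
    (fun k hk => by
      simp only [brickWallGraph_adj_coord, Pi.add_apply, patR_zero, patR_one, hrow]; push_cast; (first | omega | (simp only [and_true, false_and, and_false, or_false] at *; omega)))
    (fun m hm k hk1 hk2 h => by
      have := congrFun h 0; simp only [Pi.add_apply, patR_zero] at this
      have := hmax m hm; omega)
    (fun k k' _ _ h => patR_inj k k' h)
    (fun k hk => by simp only [InStrip, Pi.add_apply, patR_one, hrow]; omega)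
  refine ⟨mem_FT2.2 ⟨hmem, rfl, ?_, ?_, fun m hm => ?_⟩, ?_, ?_⟩
  · dsimp only; rw [extWalk_add_of_le patR_at_zero (le_refl 2)]; simp only [Pi.add_apply, patR_one, hrow]; omega
  · dsimp only; rw [extWalk_add_of_le patR_at_zero (le_refl 2)]; simp only [Pi.add_apply, patR_zero]; omega
  · dsimp only; rw [extWalk_add_of_le patR_at_zero (le_refl 2)]
    rcases le_or_gt m n with hm' | hm'
    · rw [extWalk_of_le hm']; simp only [Pi.add_apply, patR_zero]; have := hmax m hm'; omega
    · obtain ⟨k, rfl⟩ : ∃ k, m = n + k := ⟨m - n, by omega⟩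
      rw [extWalk_add_of_le patR_at_zero (by omega : k ≤ 2)]; simp only [Pi.add_apply, patR_zero]; omega
  · rw [bottomVisits₀_extWalk patR_at_zero, h1]
    simp only [Finset.sum_range_succ, Finset.sum_range_zero, Pi.add_apply, patR_zero, patR_one, hrow]
    push_cast
    split_ifs <;> (first | omega | simp only [false_and] at *)
  · rw [extWalk_add_of_le patR_at_zero (by norm_num : 1 ≤ 2)]; simp only [Pi.add_apply, patR_one, hrow]; omega

/-- Down-rung: `FT2 n → FB (n+1)`, no new level-`0` vertex. [cite: MadrasSlade1993, §8.2] -/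
theorem extD_mem_FB (hp : p ∈ FT2 n) : ((0 : Site 2), extWalk n 1 patD p.2) ∈ FB (n + 1) ∧
    bottomVisits₀ 0 (extWalk n 1 patD p.2) (n + 1) = bottomVisits₀ p.1 p.2 n ∧
    extWalk n 1 patD p.2 n 1 = 1 := by
  obtain ⟨hp, h1, hrow, hpar, hmax⟩ := mem_FT2.1 hp
  have hp' : ((0 : Site 2), p.2) ∈ stripPairs 1 n := by rw [← h1]; exact hp
  have hmem := ext_mem_stripPairs (ℓ := 1) hp' patD_at_zero
    (fun k hk => by
      simp only [brickWallGraph_adj_coord, Pi.add_apply, patD_zero, patD_one, hrow]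
      split_ifs <;> (first | omega | (simp only [true_and, not_false_eq_true] at * <;> omega)))
    (fun m hm k hk1 hk2 h => by
      have e0 := congrFun h 0; have e1 := congrFun h 1
      simp only [Pi.add_apply, patD_zero, patD_one] at e0 e1
      rcases lt_or_eq_of_le hm with hm' | rfl
      · have := hmax m hm'; omega
      · rw [hrow] at e1; split_ifs at e1 <;> omega)
    (fun k k' hk hk' h => patD_inj k k' hk hk' h)
    (fun k hk => by simp only [InStrip, Pi.add_apply, patD_one, hrow]; split_ifs <;> omega)
  refine ⟨mem_FB.2 ⟨hmem, rfl, ?_, ?_, fun m hm => ?_⟩, ?_, ?_⟩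
  · dsimp only; rw [extWalk_add_of_le patD_at_zero (le_refl 1)]; simp only [Pi.add_apply, patD_one, hrow]; split_ifs <;> (first | omega | simp only [] at *)
  · dsimp only; rw [extWalk_add_of_le patD_at_zero (le_refl 1)]; simp only [Pi.add_apply, patD_zero]; omega
  · dsimp only; rw [extWalk_add_of_le patD_at_zero (le_refl 1)]
    rcases lt_trichotomy m n with hm' | rfl | hm'
    · rw [extWalk_of_le hm'.le]; simp only [Pi.add_apply, patD_zero]; have := hmax m hm'; omega
    · rw [extWalk_of_le le_rfl]; simp only [Pi.add_apply, patD_zero]; omega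
    · obtain rfl : m = n + 1 := by omega
      rw [extWalk_add_of_le patD_at_zero (le_refl 1)]
  · rw [bottomVisits₀_extWalk patD_at_zero, h1]
    simp only [Finset.sum_range_succ, Finset.sum_range_zero, Pi.add_apply, patD_zero, patD_one, hrow]
    push_cast
    split_ifs <;> omega
  · rw [extWalk_of_le le_rfl, hrow]

/-! ### The renewal inequalities -/

/-- A walk of `stripPairs T n` is frozen after time `n`. [cite: BeatonBousquetMelouDeGierDuminilCopinGuttmann2014, §3.2 (arXiv v5 p. 10: the walks confined to the strip S_T and their bottom contacts bc(ω) in C_{T,k}(y,z)); lane bookkeeping, not in print] -/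
theorem frozen_of_mem_stripPairs {T : ℕ} (hp : p ∈ stripPairs T n) : ∀ i, n ≤ i → p.2 i = p.2 n :=
  (Zd.mem_saws.1 (mem_stripPairs.1 hp).2.1).2.1

/-- **`y·b_n + t⁽²⁾_{n+1} ≤ b_{n+2}`**. [cite: MadrasSlade1993, §8.2; BeatonBousquetMelouDeGierDuminilCopinGuttmann2014, §3.2 (arXiv v5 p. 10)] -/
theorem renewal_bB (n : ℕ) (hy : 0 ≤ y) : y * bB n y + bT2 (n + 1) y ≤ bB (n + 2) y := by
  classical
  have hR : Set.InjOn (fun p : Site 2 × (ℕ → Site 2) => ((0 : Site 2), extWalk n 2 patR p.2)) ↑(FB n) := by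
    intro p hp q hq h
    obtain ⟨hp', hp1, -⟩ := mem_FB.1 (Finset.mem_coe.1 hp)
    obtain ⟨hq', hq1, -⟩ := mem_FB.1 (Finset.mem_coe.1 hq)
    have h' : extWalk n 2 patR p.2 = extWalk n 2 patR q.2 := congrArg Prod.snd h
    exact Prod.ext (by rw [hp1, hq1])
      (extWalk_injective_of_frozen (frozen_of_mem_stripPairs hp') (frozen_of_mem_stripPairs hq') h')
  have hD : Set.InjOn (fun p : Site 2 × (ℕ → Site 2) => ((0 : Site 2), extWalk (n + 1) 1 patD p.2))
      ↑(FT2 (n + 1)) := by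
    intro p hp q hq h
    obtain ⟨hp', hp1, -⟩ := mem_FT2.1 (Finset.mem_coe.1 hp)
    obtain ⟨hq', hq1, -⟩ := mem_FT2.1 (Finset.mem_coe.1 hq)
    have h' : extWalk (n + 1) 1 patD p.2 = extWalk (n + 1) 1 patD q.2 := congrArg Prod.snd h
    exact Prod.ext (by rw [hp1, hq1])
      (extWalk_injective_of_frozen (frozen_of_mem_stripPairs hp') (frozen_of_mem_stripPairs hq') h')
  have hsub : (FB n).image (fun p => ((0 : Site 2), extWalk n 2 patR p.2)) ∪
      (FT2 (n + 1)).image (fun p => ((0 : Site 2), extWalk (n + 1) 1 patD p.2)) ⊆ FB (n + 2) := by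
    intro q hq
    rcases Finset.mem_union.1 hq with hq | hq
    · obtain ⟨p, hp, rfl⟩ := Finset.mem_image.1 hq; exact (extR_mem_FB hp).1
    · obtain ⟨p, hp, rfl⟩ := Finset.mem_image.1 hq; exact (extD_mem_FB hp).1
  have hdisj : Disjoint ((FB n).image (fun p => ((0 : Site 2), extWalk n 2 patR p.2)))
      ((FT2 (n + 1)).image (fun p => ((0 : Site 2), extWalk (n + 1) 1 patD p.2))) := by
    rw [Finset.disjoint_left]
    intro q hq hq'
    obtain ⟨p, hp, rfl⟩ := Finset.mem_image.1 hq
    obtain ⟨p', hp', h⟩ := Finset.mem_image.1 hq'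
    have h1 := (extR_mem_FB hp).2.2
    have h2 := (extD_mem_FB hp').2.2
    have h3 : extWalk (n + 1) 1 patD p'.2 (n + 1) = extWalk n 2 patR p.2 (n + 1) :=
      congrFun (congrArg Prod.snd h) (n + 1)
    rw [h3, h1] at h2
    exact absurd h2 (by norm_num)
  calc y * bB n y + bT2 (n + 1) y
      = ∑ p ∈ FB n, y ^ bottomVisits₀ (0 : Site 2) (extWalk n 2 patR p.2) (n + 2) +
          ∑ p ∈ FT2 (n + 1), y ^ bottomVisits₀ (0 : Site 2) (extWalk (n + 1) 1 patD p.2) (n + 1 + 1) := by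
        rw [bB, bT2, Finset.mul_sum]
        congr 1
        · exact Finset.sum_congr rfl fun p hp => by rw [(extR_mem_FB hp).2.1, pow_succ, mul_comm]
        · exact Finset.sum_congr rfl fun p hp => by rw [(extD_mem_FB hp).2.1]
    _ = ∑ q ∈ (FB n).image (fun p => ((0 : Site 2), extWalk n 2 patR p.2)),
            y ^ bottomVisits₀ q.1 q.2 (n + 2) +
          ∑ q ∈ (FT2 (n + 1)).image (fun p => ((0 : Site 2), extWalk (n + 1) 1 patD p.2)),
            y ^ bottomVisits₀ q.1 q.2 (n + 2) := by
        rw [Finset.sum_image hR, Finset.sum_image hD]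
    _ = ∑ q ∈ (FB n).image (fun p => ((0 : Site 2), extWalk n 2 patR p.2)) ∪
          (FT2 (n + 1)).image (fun p => ((0 : Site 2), extWalk (n + 1) 1 patD p.2)),
            y ^ bottomVisits₀ q.1 q.2 (n + 2) := (Finset.sum_union hdisj).symm
    _ ≤ bB (n + 2) y := Finset.sum_le_sum_of_subset_of_nonneg hsub fun q _ _ => pow_nonneg hy _

/-- **`y·b_n + t_{n+1} ≤ t_{n+3}`**. [cite: MadrasSlade1993, §8.2; BeatonBousquetMelouDeGierDuminilCopinGuttmann2014, §3.2 (arXiv v5 p. 10)] -/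
theorem renewal_bT (n : ℕ) (hy : 0 ≤ y) : y * bB n y + bT (n + 1) y ≤ bT (n + 3) y := by
  classical
  have hU : Set.InjOn (fun p : Site 2 × (ℕ → Site 2) => ((0 : Site 2), extWalk n 3 patU p.2)) ↑(FB n) := by
    intro p hp q hq h
    obtain ⟨hp', hp1, -⟩ := mem_FB.1 (Finset.mem_coe.1 hp)
    obtain ⟨hq', hq1, -⟩ := mem_FB.1 (Finset.mem_coe.1 hq)
    have h' : extWalk n 3 patU p.2 = extWalk n 3 patU q.2 := congrArg Prod.snd h
    exact Prod.ext (by rw [hp1, hq1])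
      (extWalk_injective_of_frozen (frozen_of_mem_stripPairs hp') (frozen_of_mem_stripPairs hq') h')
  have hR : Set.InjOn (fun p : Site 2 × (ℕ → Site 2) => ((0 : Site 2), extWalk (n + 1) 2 patR p.2))
      ↑(FT (n + 1)) := by
    intro p hp q hq h
    obtain ⟨hp', hp1, -⟩ := mem_FT.1 (Finset.mem_coe.1 hp)
    obtain ⟨hq', hq1, -⟩ := mem_FT.1 (Finset.mem_coe.1 hq)
    have h' : extWalk (n + 1) 2 patR p.2 = extWalk (n + 1) 2 patR q.2 := congrArg Prod.snd h
    exact Prod.ext (by rw [hp1, hq1])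
      (extWalk_injective_of_frozen (frozen_of_mem_stripPairs hp') (frozen_of_mem_stripPairs hq') h')
  have hsub : (FB n).image (fun p => ((0 : Site 2), extWalk n 3 patU p.2)) ∪
      (FT (n + 1)).image (fun p => ((0 : Site 2), extWalk (n + 1) 2 patR p.2)) ⊆ FT (n + 3) := by
    intro q hq
    rcases Finset.mem_union.1 hq with hq | hq
    · obtain ⟨p, hp, rfl⟩ := Finset.mem_image.1 hq; exact (extU_mem_FT hp).1
    · obtain ⟨p, hp, rfl⟩ := Finset.mem_image.1 hq; exact FT2_subset_FT _ (extR_mem_FT2 hp).1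
  have hdisj : Disjoint ((FB n).image (fun p => ((0 : Site 2), extWalk n 3 patU p.2)))
      ((FT (n + 1)).image (fun p => ((0 : Site 2), extWalk (n + 1) 2 patR p.2))) := by
    rw [Finset.disjoint_left]
    intro q hq hq'
    obtain ⟨p, hp, rfl⟩ := Finset.mem_image.1 hq
    obtain ⟨p', hp', h⟩ := Finset.mem_image.1 hq'
    have h1 := (extU_mem_FT hp).2.2
    have h2 := (extR_mem_FT2 hp').2.2
    have h3 : extWalk (n + 1) 2 patR p'.2 (n + 1 + 1) = extWalk n 3 patU p.2 (n + 2) :=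
      congrFun (congrArg Prod.snd h) (n + 2)
    rw [h3, h1] at h2
    exact absurd h2 (by norm_num)
  calc y * bB n y + bT (n + 1) y
      = ∑ p ∈ FB n, y ^ bottomVisits₀ (0 : Site 2) (extWalk n 3 patU p.2) (n + 3) +
          ∑ p ∈ FT (n + 1), y ^ bottomVisits₀ (0 : Site 2) (extWalk (n + 1) 2 patR p.2) (n + 1 + 2) := by
        rw [bB, bT, Finset.mul_sum]
        congr 1
        · exact Finset.sum_congr rfl fun p hp => by rw [(extU_mem_FT hp).2.1, pow_succ, mul_comm]
        · exact Finset.sum_congr rfl fun p hp => by rw [(extR_mem_FT2 hp).2.1]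
    _ = ∑ q ∈ (FB n).image (fun p => ((0 : Site 2), extWalk n 3 patU p.2)),
            y ^ bottomVisits₀ q.1 q.2 (n + 3) +
          ∑ q ∈ (FT (n + 1)).image (fun p => ((0 : Site 2), extWalk (n + 1) 2 patR p.2)),
            y ^ bottomVisits₀ q.1 q.2 (n + 3) := by
        rw [Finset.sum_image hU, Finset.sum_image hR]
    _ = ∑ q ∈ (FB n).image (fun p => ((0 : Site 2), extWalk n 3 patU p.2)) ∪
          (FT (n + 1)).image (fun p => ((0 : Site 2), extWalk (n + 1) 2 patR p.2)),
            y ^ bottomVisits₀ q.1 q.2 (n + 3) := (Finset.sum_union hdisj).symm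
    _ ≤ bT (n + 3) y := Finset.sum_le_sum_of_subset_of_nonneg hsub fun q _ _ => pow_nonneg hy _

/-- **`t_n ≤ t⁽²⁾_{n+2}`**. [cite: MadrasSlade1993, §8.2; BeatonBousquetMelouDeGierDuminilCopinGuttmann2014, §3.2 (arXiv v5 p. 10)] -/
theorem renewal_bT2 (n : ℕ) (hy : 0 ≤ y) : bT n y ≤ bT2 (n + 2) y := by
  classical
  have hR : Set.InjOn (fun p : Site 2 × (ℕ → Site 2) => ((0 : Site 2), extWalk n 2 patR p.2)) ↑(FT n) := by
    intro p hp q hq h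
    obtain ⟨hp', hp1, -⟩ := mem_FT.1 (Finset.mem_coe.1 hp)
    obtain ⟨hq', hq1, -⟩ := mem_FT.1 (Finset.mem_coe.1 hq)
    have h' : extWalk n 2 patR p.2 = extWalk n 2 patR q.2 := congrArg Prod.snd h
    exact Prod.ext (by rw [hp1, hq1])
      (extWalk_injective_of_frozen (frozen_of_mem_stripPairs hp') (frozen_of_mem_stripPairs hq') h')
  have hsub : (FT n).image (fun p => ((0 : Site 2), extWalk n 2 patR p.2)) ⊆ FT2 (n + 2) := by
    intro q hq
    obtain ⟨p, hp, rfl⟩ := Finset.mem_image.1 hq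
    exact (extR_mem_FT2 hp).1
  calc bT n y = ∑ p ∈ FT n, y ^ bottomVisits₀ (0 : Site 2) (extWalk n 2 patR p.2) (n + 2) := by
        rw [bT]
        exact Finset.sum_congr rfl fun p hp => by rw [(extR_mem_FT2 hp).2.1]
    _ = ∑ q ∈ (FT n).image (fun p => ((0 : Site 2), extWalk n 2 patR p.2)),
            y ^ bottomVisits₀ q.1 q.2 (n + 2) := by rw [Finset.sum_image hR]
    _ ≤ bT2 (n + 2) y := Finset.sum_le_sum_of_subset_of_nonneg hsub fun q _ _ => pow_nonneg hy _

/-! ### The divergence criterion -/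

/-- **Divergence criterion for `Σ_n C_{1,n}(y,1) xⁿ`** from the renewal inequalities: if `0 < x`, `x² < 1`,
`0 ≤ y` and `(1 − y x²)(1 − x²) ≤ y x⁶` (i.e. `det(1 − M(x)) ≤ 0` for the forward automaton), the series
diverges. [cite: MadrasSlade1993, §8.2 (transfer matrices for strips); BeatonBousquetMelouDeGierDuminilCopinGuttmann2014, Corollary 8 (arXiv v5 p. 12)] -/
theorem not_summable_stripZ₀_one_mul_pow (hx : 0 < x) (hx1 : x ^ 2 < 1) (hy : 0 ≤ y)
    (hdet : (1 - y * x ^ 2) * (1 - x ^ 2) ≤ y * x ^ 6) :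
    ¬ Summable (fun n : ℕ => stripZ₀ 1 n y * x ^ n) := by
  intro hS
  have hxn : ∀ n, 0 ≤ x ^ n := fun n => pow_nonneg hx.le n
  have sB : Summable (fun n : ℕ => bB n y * x ^ n) :=
    hS.of_nonneg_of_le (fun n => mul_nonneg (bB_nonneg n hy) (hxn n))
      (fun n => mul_le_mul_of_nonneg_right (bB_le_stripZ₀ n hy) (hxn n))
  have sT : Summable (fun n : ℕ => bT n y * x ^ n) :=
    hS.of_nonneg_of_le (fun n => mul_nonneg (bT_nonneg n hy) (hxn n))
      (fun n => mul_le_mul_of_nonneg_right (bT_le_stripZ₀ n hy) (hxn n))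
  have sT2 : Summable (fun n : ℕ => bT2 n y * x ^ n) :=
    hS.of_nonneg_of_le (fun n => mul_nonneg (bT2_nonneg n hy) (hxn n))
      (fun n => mul_le_mul_of_nonneg_right (bT2_le_stripZ₀ n hy) (hxn n))
  set B := ∑' n, bB n y * x ^ n with hB
  set T := ∑' n, bT n y * x ^ n with hT
  set T2 := ∑' n, bT2 n y * x ^ n with hT2
  have hB0 : 0 ≤ B := tsum_nonneg fun n => mul_nonneg (bB_nonneg n hy) (hxn n)
  -- (1) x² T ≤ T2
  have h1 : x ^ 2 * T ≤ T2 := by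
    have s2 : Summable (fun n : ℕ => bT2 (n + 2) y * x ^ (n + 2)) := (summable_nat_add_iff (f := fun n => bT2 n y * x ^ n) 2).2 sT2
    have sF : Summable (fun n : ℕ => x ^ 2 * (bT n y * x ^ n)) := sT.mul_left _
    have hF : ∀ n, x ^ 2 * (bT n y * x ^ n) ≤ bT2 (n + 2) y * x ^ (n + 2) := fun n => by
      rw [show x ^ 2 * (bT n y * x ^ n) = bT n y * x ^ (n + 2) by ring]
      exact mul_le_mul_of_nonneg_right (renewal_bT2 n hy) (hxn _)
    calc x ^ 2 * T = ∑' n, x ^ 2 * (bT n y * x ^ n) := by rw [tsum_mul_left]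
      _ ≤ ∑' n, bT2 (n + 2) y * x ^ (n + 2) := sF.tsum_le_tsum hF s2
      _ ≤ T2 := by
          rw [hT2, ← sT2.sum_add_tsum_nat_add 2]
          exact le_add_of_nonneg_left (Finset.sum_nonneg fun n _ => mul_nonneg (bT2_nonneg n hy) (hxn n))
  -- (2) y x³ B + x² T ≤ T
  have h2 : y * x ^ 3 * B + x ^ 2 * T ≤ T := by
    have s3 : Summable (fun n : ℕ => bT (n + 3) y * x ^ (n + 3)) := (summable_nat_add_iff (f := fun n => bT n y * x ^ n) 3).2 sT
    have s1 : Summable (fun n : ℕ => bT (n + 1) y * x ^ (n + 1)) := (summable_nat_add_iff (f := fun n => bT n y * x ^ n) 1).2 sT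
    have e1 : ∑' n, bT (n + 1) y * x ^ (n + 1) = T := by
      rw [hT, ← sT.sum_add_tsum_nat_add 1, Finset.sum_range_one, bT_zero, zero_mul, zero_add]
    have sF1 : Summable (fun n : ℕ => y * x ^ 3 * (bB n y * x ^ n)) := sB.mul_left _
    have sF2 : Summable (fun n : ℕ => x ^ 2 * (bT (n + 1) y * x ^ (n + 1))) := s1.mul_left _
    have hF : ∀ n, y * x ^ 3 * (bB n y * x ^ n) + x ^ 2 * (bT (n + 1) y * x ^ (n + 1)) ≤
        bT (n + 3) y * x ^ (n + 3) := fun n => by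
      rw [show y * x ^ 3 * (bB n y * x ^ n) + x ^ 2 * (bT (n + 1) y * x ^ (n + 1)) =
        (y * bB n y + bT (n + 1) y) * x ^ (n + 3) by ring]
      exact mul_le_mul_of_nonneg_right (renewal_bT n hy) (hxn _)
    calc y * x ^ 3 * B + x ^ 2 * T
        = ∑' n, y * x ^ 3 * (bB n y * x ^ n) + ∑' n, x ^ 2 * (bT (n + 1) y * x ^ (n + 1)) := by
          rw [tsum_mul_left, tsum_mul_left, e1]
      _ = ∑' n, (y * x ^ 3 * (bB n y * x ^ n) + x ^ 2 * (bT (n + 1) y * x ^ (n + 1))) :=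
          (sF1.tsum_add sF2).symm
      _ ≤ ∑' n, bT (n + 3) y * x ^ (n + 3) := (sF1.add sF2).tsum_le_tsum hF s3
      _ ≤ T := by
          rw [hT, ← sT.sum_add_tsum_nat_add 3]
          exact le_add_of_nonneg_left (Finset.sum_nonneg fun n _ => mul_nonneg (bT_nonneg n hy) (hxn n))
  -- (3) 1 + y x² B + x T2 ≤ B
  have h3 : 1 + y * x ^ 2 * B + x * T2 ≤ B := by
    have s2 : Summable (fun n : ℕ => bB (n + 2) y * x ^ (n + 2)) := (summable_nat_add_iff (f := fun n => bB n y * x ^ n) 2).2 sB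
    have s1 : Summable (fun n : ℕ => bT2 (n + 1) y * x ^ (n + 1)) := (summable_nat_add_iff (f := fun n => bT2 n y * x ^ n) 1).2 sT2
    have e1 : ∑' n, bT2 (n + 1) y * x ^ (n + 1) = T2 := by
      rw [hT2, ← sT2.sum_add_tsum_nat_add 1, Finset.sum_range_one, bT2_zero, zero_mul, zero_add]
    have e2 : bB 0 y + ∑' n, bB (n + 2) y * x ^ (n + 2) ≤ B := by
      rw [hB, ← sB.sum_add_tsum_nat_add 2, Finset.sum_range_succ, Finset.sum_range_one, pow_zero, mul_one]
      have := mul_nonneg (bB_nonneg 1 hy) (hxn 1)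
      linarith
    have sF1 : Summable (fun n : ℕ => y * x ^ 2 * (bB n y * x ^ n)) := sB.mul_left _
    have sF2 : Summable (fun n : ℕ => x * (bT2 (n + 1) y * x ^ (n + 1))) := s1.mul_left _
    have hF : ∀ n, y * x ^ 2 * (bB n y * x ^ n) + x * (bT2 (n + 1) y * x ^ (n + 1)) ≤
        bB (n + 2) y * x ^ (n + 2) := fun n => by
      rw [show y * x ^ 2 * (bB n y * x ^ n) + x * (bT2 (n + 1) y * x ^ (n + 1)) =
        (y * bB n y + bT2 (n + 1) y) * x ^ (n + 2) by ring]
      exact mul_le_mul_of_nonneg_right (renewal_bB n hy) (hxn _)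
    have h1' : 1 ≤ bB 0 y := one_le_bB_zero hy
    calc 1 + y * x ^ 2 * B + x * T2
        ≤ bB 0 y + (y * x ^ 2 * B + x * T2) := by linarith
      _ = bB 0 y + (∑' n, y * x ^ 2 * (bB n y * x ^ n) + ∑' n, x * (bT2 (n + 1) y * x ^ (n + 1))) := by
          rw [tsum_mul_left, tsum_mul_left, e1]
      _ = bB 0 y + ∑' n, (y * x ^ 2 * (bB n y * x ^ n) + x * (bT2 (n + 1) y * x ^ (n + 1))) := by
          rw [(sF1.tsum_add sF2).symm]
      _ ≤ bB 0 y + ∑' n, bB (n + 2) y * x ^ (n + 2) := by linarith [(sF1.add sF2).tsum_le_tsum hF s2]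
      _ ≤ B := e2
  -- combine: B·det(1 − M) ≥ 1 − x² > 0, contradiction with det ≤ 0 and B ≥ 0
  have hu : 0 < 1 - x ^ 2 := by linarith
  have a1 : x ^ 3 * T ≤ x * T2 :=
    calc x ^ 3 * T = x * (x ^ 2 * T) := by ring
      _ ≤ x * T2 := mul_le_mul_of_nonneg_left h1 hx.le
  have a2 : x ^ 3 * T ≤ B - 1 - y * x ^ 2 * B := by linarith
  have a3 : (1 - x ^ 2) * (x ^ 3 * T) ≤ (1 - x ^ 2) * (B - 1 - y * x ^ 2 * B) :=
    mul_le_mul_of_nonneg_left a2 hu.le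
  have a4 : x ^ 3 * (y * x ^ 3 * B) ≤ x ^ 3 * ((1 - x ^ 2) * T) :=
    mul_le_mul_of_nonneg_left (by linarith) (hxn 3)
  have a5 : y * x ^ 6 * B ≤ (1 - x ^ 2) * (B - 1 - y * x ^ 2 * B) :=
    calc y * x ^ 6 * B = x ^ 3 * (y * x ^ 3 * B) := by ring
      _ ≤ x ^ 3 * ((1 - x ^ 2) * T) := a4
      _ = (1 - x ^ 2) * (x ^ 3 * T) := by ring
      _ ≤ (1 - x ^ 2) * (B - 1 - y * x ^ 2 * B) := a3
  have a6 : 1 - x ^ 2 ≤ B * ((1 - y * x ^ 2) * (1 - x ^ 2) - y * x ^ 6) := by linear_combination a5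
  have a7 : B * ((1 - y * x ^ 2) * (1 - x ^ 2) - y * x ^ 6) ≤ 0 :=
    mul_nonpos_of_nonneg_of_nonpos hB0 (sub_nonpos.2 hdet)
  linarith

end Literature.Probability.RandomPlanarGeometry.SAW.HexBW
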